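import Mathlib
import HarnessLib

/-!
# Dyadic layer-cake summation for the far zone, wide form (stub `stub_farLayerCakeWide`)

Line `smooth-rough-lattice-acquisition` of crux stmt-Parity-11291
(`Summit.Parity.BatemanHorn.Theses.AlmostPrimeZeros.SystemZeroRepulsion`): the summation lemma
behind the reshaped far zone S2′ (`stub_farZone_of_farMomentWide`, file
`AlmostPrimeZerosSystemZeroRepulsionFarZoneWide.lean`).

Let `S` be a finite multiset of complex numbers with `‖1 − ρ‖ ≥ L ≥ 1` on `S`, let
`0 < R ≤ e^{L/2}` and `B, B′ ≥ 0`.  If on every dyadic shell below `R` the count is linear plus a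
quadratic correction, `#{ρ ∈ S : ‖1 − ρ‖ ≤ t} ≤ B L t + B′ t²/L` for `t = L 2^{i+1}` whenever
`L 2^i < R`, and `#S ≤ D`, then `Σ_{ρ ∈ S} ‖1 − ρ‖⁻² ≤ 4B + 8B′ + D R⁻²`.

Proof.  A root with `‖1 − ρ‖ ≥ R` contributes at most `R⁻²`; a root with `L ≤ ‖1 − ρ‖ < R`
lies in a shell `L 2^i ≤ ‖1 − ρ‖ < L 2^{i+1}` with `L 2^i < R`, so `i < J := ⌊L⌋₊ + 1` (because
`R ≤ e^{L/2} ≤ e^{J/2} ≤ 2^J ≤ L 2^J`, as `e ≤ 4`), and contributes at most `(L 2^i)⁻²`;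
swapping the sums, shell `i` contributes at most
`(L 2^i)⁻² (B L · L 2^{i+1} + B′ (L 2^{i+1})²/L) = 2B 2^{−i} + 4B′/L`; the first part is a
geometric series with sum `≤ 4B`, the second summed over `i < J` is `≤ 4B′J/L ≤ 4B′(L+1)/L ≤ 8B′`.

References: E. C. Titchmarsh, *The Theory of Functions*, 2nd ed., §3.61 (the layer-cake use of
Jensen counts); the lemma itself is elementary bookkeeping.
-/

noncomputable section

namespace Summit.Parity.BatemanHorn.Cruxes.SystemZeroRepulsion.SmoothRoughLatticeAcquisition

/-- Summing a constant indicator over a multiset counts the filtered elements. -/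
private lemma farW_sum_map_ite_const {ι : Type*} (m : Multiset ι) (p : ι → Prop)
    [DecidablePred p] (v : ℝ) :
    (m.map fun s => if p s then v else 0).sum = v * ((m.filter p).card : ℝ) := by
  -- adapted from
  -- Summits/Parity/BatemanHorn/Theorems/AlmostPrimeZerosSystemZeroRepulsionFarZone.lean
  induction m using Multiset.induction_on with
  | empty => simp
  | cons a m ih =>
    by_cases h : p a
    · rw [Multiset.map_cons, Multiset.sum_cons, ih, Multiset.filter_cons_of_pos _ h,
        Multiset.card_cons, if_pos h]
      push_cast
      ring
    · rw [Multiset.map_cons, Multiset.sum_cons, ih, Multiset.filter_cons_of_neg _ h, if_neg h,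
        zero_add]

/-- Swapping a multiset sum with a finite sum. -/
private lemma farW_sum_map_finset_sum {ι κ : Type*} (m : Multiset ι) (u : Finset κ)
    (g : ι → κ → ℝ) :
    (m.map fun s => ∑ i ∈ u, g s i).sum = ∑ i ∈ u, (m.map fun s => g s i).sum := by
  -- adapted from
  -- Summits/Parity/BatemanHorn/Theorems/AlmostPrimeZerosSystemZeroRepulsionFarZone.lean
  induction m using Multiset.induction_on with
  | empty => simp
  | cons a m ih => simp [ih, Finset.sum_add_distrib]

/-- The shell-index bound: for `L ≥ 1`, `e^{L/2} ≤ L · 2^{⌊L⌋₊ + 1}`, because `L < ⌊L⌋₊ + 1` and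
`e^{1/2} ≤ 2` (`log 2 > 1/2`). -/
private lemma farW_exp_half_le {L : ℝ} (hL : 1 ≤ L) :
    Real.exp (L / 2) ≤ L * 2 ^ (⌊L⌋₊ + 1) := by
  have hJ : L ≤ ((⌊L⌋₊ + 1 : ℕ) : ℝ) := by
    push_cast
    exact (Nat.lt_floor_add_one L).le
  have hhalf : Real.exp (1 / 2) ≤ 2 := by
    calc Real.exp (1 / 2) ≤ Real.exp (Real.log 2) :=
          Real.exp_le_exp.2 (by linarith [Real.log_two_gt_d9])
      _ = 2 := Real.exp_log two_pos
  calc Real.exp (L / 2) ≤ Real.exp (((⌊L⌋₊ + 1 : ℕ) : ℝ) * (1 / 2)) :=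
        Real.exp_le_exp.2 (by linarith)
    _ = Real.exp (1 / 2) ^ (⌊L⌋₊ + 1) := Real.exp_nat_mul _ _
    _ ≤ 2 ^ (⌊L⌋₊ + 1) := pow_le_pow_left₀ (Real.exp_pos _).le hhalf _
    _ ≤ L * 2 ^ (⌊L⌋₊ + 1) := le_mul_of_one_le_left (by positivity) hL

/-- **`stub_farLayerCakeWide` — dyadic layer-cake summation for the far zone, wide form.**  Let
`S` be a finite multiset of complex numbers with `‖1 − ρ‖ ≥ L ≥ 1` on `S`, and let
`0 < R ≤ e^{L/2}`, `B, B′ ≥ 0`.  If on every dyadic shell below `R` one has the count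
`#{ρ ∈ S : ‖1 − ρ‖ ≤ L 2^{i+1}} ≤ B L · L 2^{i+1} + B′ (L 2^{i+1})²/L` whenever `L 2^i < R`, and
`#S ≤ D`, then `Σ_{ρ ∈ S} ‖1 − ρ‖⁻² ≤ 4B + 8B′ + D R⁻²`: a root with `‖1 − ρ‖ ≥ R` contributes at
most `R⁻²`; a root with `L ≤ ‖1 − ρ‖ < R` lies in a shell `L 2^i ≤ ‖1 − ρ‖ < L 2^{i+1}` with
`L 2^i < R ≤ e^{L/2} ≤ L 2^J`, `J = ⌊L⌋₊ + 1 ≤ 2L`, and contributes at most `(L 2^i)⁻²`; swapping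
the sums, shell `i < J` contributes at most `2B 2^{−i} + 4B′/L`, and
`Σ_{i<J} (2B 2^{−i} + 4B′/L) ≤ 4B + 4B′J/L ≤ 4B + 8B′`. -/
theorem stub_farLayerCakeWide :
    ∀ (S : Multiset ℂ) (L R B B' D : ℝ), 1 ≤ L → 0 < R → R ≤ Real.exp (L / 2) → 0 ≤ B →
      0 ≤ B' → (∀ ρ ∈ S, L ≤ ‖(1 : ℂ) - ρ‖) →
      (∀ i : ℕ, L * 2 ^ i < R →
        ((S.filter fun ρ : ℂ => ‖(1 : ℂ) - ρ‖ ≤ L * 2 ^ (i + 1)).card : ℝ) ≤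
          B * L * (L * 2 ^ (i + 1)) + B' * (L * 2 ^ (i + 1)) ^ 2 / L) →
      (S.card : ℝ) ≤ D →
      (S.map fun ρ : ℂ => (‖(1 : ℂ) - ρ‖ ^ 2)⁻¹).sum ≤ 4 * B + 8 * B' + D * (R ^ 2)⁻¹ := by
  -- adapted from `far_layerCake` in
  -- Summits/Parity/BatemanHorn/Theorems/AlmostPrimeZerosSystemZeroRepulsionFarZone.lean
  intro S L R B B' D hL hR hRL hB hB' hfar hcount hcard
  classical
  have hL0 : 0 < L := one_pos.trans_le hL
  have hLne : L ≠ 0 := hL0.ne'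
  -- the shell index bound `J = ⌊L⌋₊ + 1`, `R ≤ L 2^J`, `J ≤ 2L`; the shells `I` below `R`
  set J : ℕ := ⌊L⌋₊ + 1 with hJdef
  have hJ : R ≤ L * 2 ^ J := hRL.trans (farW_exp_half_le hL)
  have hJL : (J : ℝ) ≤ 2 * L := by
    rw [hJdef]
    push_cast
    linarith [Nat.floor_le hL0.le]
  set I : Finset ℕ := (Finset.range J).filter (fun i => L * 2 ^ i < R) with hI
  -- the weight of shell `i` seen by `ρ`
  set g : ℂ → ℕ → ℝ := fun ρ i =>
    if ‖(1 : ℂ) - ρ‖ ≤ L * 2 ^ (i + 1) then ((L * 2 ^ i) ^ 2)⁻¹ else 0 with hg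
  have hg0 : ∀ ρ i, 0 ≤ g ρ i := fun ρ i => by
    simp only [hg]
    split_ifs <;> positivity
  have hR2 : 0 ≤ (R ^ 2)⁻¹ := by positivity
  -- Step 1: each root's inverse square is bounded by the weights of the shells it meets.
  have hroot : ∀ ρ ∈ S, (‖(1 : ℂ) - ρ‖ ^ 2)⁻¹ ≤ (R ^ 2)⁻¹ + ∑ i ∈ I, g ρ i := by
    intro ρ hρ
    have hsum0 : 0 ≤ ∑ i ∈ I, g ρ i := Finset.sum_nonneg fun i _ => hg0 ρ i
    rcases le_or_gt R ‖(1 : ℂ) - ρ‖ with hRρ | hρR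
    · have h : (‖(1 : ℂ) - ρ‖ ^ 2)⁻¹ ≤ (R ^ 2)⁻¹ :=
        inv_anti₀ (by positivity) (pow_le_pow_left₀ hR.le hRρ 2)
      linarith
    · obtain ⟨i, hi1, hi2⟩ := exists_nat_pow_near
        (show 1 ≤ ‖(1 : ℂ) - ρ‖ / L by rw [le_div_iff₀ hL0, one_mul]; exact hfar ρ hρ) one_lt_two
      rw [le_div_iff₀ hL0, mul_comm] at hi1
      rw [div_lt_iff₀ hL0, mul_comm] at hi2
      have hiR : L * 2 ^ i < R := hi1.trans_lt hρR
      have hiI : i ∈ I :=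
        Finset.mem_filter.2 ⟨Finset.mem_range.2 ((pow_lt_pow_iff_right₀ one_lt_two).1
          (lt_of_mul_lt_mul_left (hiR.trans_le hJ) hL0.le)), hiR⟩
      have h1 : (‖(1 : ℂ) - ρ‖ ^ 2)⁻¹ ≤ g ρ i := by
        simp only [hg, if_pos hi2.le]
        exact inv_anti₀ (by positivity) (pow_le_pow_left₀ (by positivity) hi1 2)
      linarith [Finset.single_le_sum (f := g ρ) (fun j _ => hg0 ρ j) hiI]
  -- Step 2: sum over the roots and swap the sums.
  have hswap : (S.map fun ρ : ℂ => (‖(1 : ℂ) - ρ‖ ^ 2)⁻¹).sum ≤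
      (S.card : ℝ) * (R ^ 2)⁻¹ + ∑ i ∈ I, ((L * 2 ^ i) ^ 2)⁻¹ *
        ((S.filter fun ρ : ℂ => ‖(1 : ℂ) - ρ‖ ≤ L * 2 ^ (i + 1)).card : ℝ) := by
    refine (Multiset.sum_map_le_sum_map _ _ hroot).trans_eq ?_
    rw [Multiset.sum_map_add, Multiset.map_const', Multiset.sum_replicate, nsmul_eq_mul,
      farW_sum_map_finset_sum]
    simp only [hg, farW_sum_map_ite_const]
  -- Step 3: shell `i` contributes at most `2B 2^{-i} + 4B'/L`.
  have hterm : ∀ i ∈ I, ((L * 2 ^ i) ^ 2)⁻¹ *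
      ((S.filter fun ρ : ℂ => ‖(1 : ℂ) - ρ‖ ≤ L * 2 ^ (i + 1)).card : ℝ) ≤
        2 * B * ((2 : ℝ)⁻¹) ^ i + 4 * B' / L := by
    intro i hi
    refine (mul_le_mul_of_nonneg_left (hcount i (Finset.mem_filter.1 hi).2)
      (by positivity)).trans_eq ?_
    rw [inv_pow, pow_succ]
    field_simp
    ring
  have hgeom : ∑ i ∈ Finset.range J, ((2 : ℝ)⁻¹) ^ i ≤ 2 := by
    have h := geom_sum_Ico_le_of_lt_one (m := 0) (n := J)
      (by norm_num : (0 : ℝ) ≤ 2⁻¹) (by norm_num)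
    rw [← Finset.range_eq_Ico] at h
    exact h.trans_eq (by norm_num)
  have hsumI : ∑ i ∈ I, (2 * B * ((2 : ℝ)⁻¹) ^ i + 4 * B' / L) ≤ 4 * B + 8 * B' := by
    rw [Finset.sum_add_distrib, Finset.sum_const, nsmul_eq_mul, ← Finset.mul_sum]
    have h : ∑ i ∈ I, ((2 : ℝ)⁻¹) ^ i ≤ ∑ i ∈ Finset.range J, ((2 : ℝ)⁻¹) ^ i :=
      Finset.sum_le_sum_of_subset_of_nonneg (Finset.filter_subset _ _)
        fun i _ _ => by positivity
    have hIJ : (I.card : ℝ) ≤ J := by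
      exact_mod_cast (Finset.card_filter_le _ _).trans (Finset.card_range J).le
    have h4 : (I.card : ℝ) * (4 * B' / L) ≤ 8 * B' :=
      calc (I.card : ℝ) * (4 * B' / L) ≤ 2 * L * (4 * B' / L) :=
            mul_le_mul_of_nonneg_right (hIJ.trans hJL) (by positivity)
        _ = 8 * B' := by
            field_simp
            ring
    nlinarith [h.trans hgeom]
  calc (S.map fun ρ : ℂ => (‖(1 : ℂ) - ρ‖ ^ 2)⁻¹).sum ≤ _ := hswap
    _ ≤ D * (R ^ 2)⁻¹ + ∑ i ∈ I, (2 * B * ((2 : ℝ)⁻¹) ^ i + 4 * B' / L) :=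
        add_le_add (mul_le_mul_of_nonneg_right hcard hR2) (Finset.sum_le_sum hterm)
    _ ≤ 4 * B + 8 * B' + D * (R ^ 2)⁻¹ := by linarith

end Summit.Parity.BatemanHorn.Cruxes.SystemZeroRepulsion.SmoothRoughLatticeAcquisition

end
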